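import Mathlib

/-!
# SoloBlindElementaryTwo — the structural lock T0(5), corollary (b″):
# a non-degenerate limit of discrete series on ANY host forces the slot action of `Gal(ℚ̄/M'')`
# to be ELEMENTARY ABELIAN of exponent two — i.e. `K·M''/M''` multiquadratic

Solo seat `solo-Langlands-blind`, session 12; sequel to `SoloBlindWeylDivisibility` (T0(5)),
`SoloBlindNoncompactRoots` and `SoloBlindTwoPower` (T0(5)(b′): `m = [K : K_cm]` is a power of `2`).
Same dictionary (module docstring of `SoloBlindWeylDivisibility`): `Γ = Γ'' = Gal(ℚ̄/M'')`,
`M'' ⊇ E_H` a totally real or CM Galois field over which the `*`-action of the host trivialises,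
`O` a live `Γ''`-orbit of slots `x : K → ℚ̄` (`|O| = m`), `q : Γ'' → A ⊆ N_{L̂}(S)/C_{L̂}(S)` with
`A` a subquotient `f : N ↠ A`, `N ≤ W = W(Δ_λ)`; `hq` = "an element centralising `S = ξ(T̂_G)` moves
no live slot".  Knapp–Zuckerman non-degeneracy of some packet member forces `Δ_λ = A₁^k`, so `W`
has exponent `2` (`SoloBlindNoncompactRoots`, `SoloBlindWeylDivisibility.mul_self_eq_one_of_closure_commuting_involutions`).

THEOREM T0(5)(b″).  Under the lock hypotheses, if `W` has exponent `2` then `Γ''` acts on the live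
orbit `O` through an abelian group of exponent `2`: `γ • γ • x = x` and `γ • δ • x = δ • γ • x`
(`smul_smul_self_of_sq_eq_one`, `smul_comm_of_sq_eq_one`).  A transitive abelian permutation group
is regular, so the image of `Γ''` in `Sym(O)` is `(ℤ/2)^j` acting simply transitively, `m = 2^j`
(recovering (b′)), and — reading the orbit of `x` as `Hom_{M''}(x(K)·M'', ℚ̄)` — the extension
`x(K)·M''/M''` is Galois with group `(ℤ/2)^j`: MULTIQUADRATIC.

FIELD CRITERION.  Let `M₀ ⊆ K^g` be the largest totally real or CM subfield of the Galois closure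
`K^g` that is Galois over `ℚ` (composita of CM/totally real Galois fields are CM/totally real, so
`M₀` exists; `M'' ∩ K^g ⊆ M₀` for every admissible `M''`, and shrinking `Γ''` only weakens the
constraint, so `M'' ∩ K^g = M₀` is the optimal case).  If some member of the archimedean packet of
some non-abelian functorial transfer of `π` to some host with totally real or CM `*`-action is a
non-degenerate limit of discrete series, then `K·M₀/M₀` is a multiquadratic Galois extension
(of degree `m = [K : K_cm]`).  Instances: the `−23` cubic field (`K^g` = its totally imaginary
`S₃`-closure, `M₀ = ℚ(√−23)`, `Gal(K^g/M₀) = C₃`): excluded, as by (b′).  A primitive quartic with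
two real places (`m = 4`; complex conjugation a transposition, so `M₀ ⊆ ℚ(√disc)` and
`Gal(K^g/M₀) ⊇ A₄`): EXCLUDED although `m` is a power of `2` — new relative to (b′).  A primitive
totally imaginary quartic (`S₄` or `A₄`; conjugations are double transpositions, the `S₃`- resp.
`C₃`-resolvent closure `R` is totally real, `M₀ ⊇ R`, `Gal(K^g/R) = V₄`): NOT excluded — `K·R/R` is
biquadratic — and indeed the count is met on a `D₆`-host over the cubic resolvent field
(`SoloBlindTwoPower`, docstring; seat notes A48), the line dying only at the real form.  So after
T0(5)(a), (b′), (b″) the fields left open by the lock itself are exactly those with `K·M₀/M₀`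
multiquadratic, the smallest being the totally imaginary primitive quartics; for them the question
"is any transfer a non-degenerate limit of discrete series on some Shimura host" is decided host by
host.  The criterion may be applied over any totally real base `F₀` in place of `ℚ` (as T0(4) was;
the proof is verbatim, the slots being `Hom_{F₀}(K F₀, ℚ̄)` and `M''` Galois over `F₀`), and this is
sometimes sharper: for a host `H′` of type `E₇` over the cubic resolvent field `r` of an
`S₄`-quartic (`E₇` has no outer automorphisms, so `E_{H′} = r` and `Γ'' = Γ_r`) the slot image is
`Gal(K^g/r) ≅ D₄`, non-abelian — excluded by (b″) over `r`, although over `ℚ` the host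
`Res_{r/ℚ} H′` has `E_H = R` and slot image `V₄`.  What (b″) leaves open in the quartic family is
recorded, not claimed: `A₄`-quartics on `E₇`-hosts over `r`, and `S₄`/`A₄`-quartics on hosts whose
outer automorphism group absorbs the odd part of `D₄` (type `D_{2k}`: dead at the real form by the
seat's computation A48, which is NOT formalised here).

[cite: KnappZuckerman1982, §1] [cite: Goldring2016, p. 348, p. 357] [cite: Clozel1990, Lemme 4.9]
[cite: Patrikis2019, Prop. 2.4.7 (arXiv:1207.6724)]
-/

namespace Summit.Langlands.Langlands.Theorems.SoloBlind

section ExponentTwo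

/-- A quotient of a subgroup of a group of exponent `2` has exponent `2`. -/
theorem sq_eq_one_of_subquotient {A W : Type*} [Group A] [Group W] (N : Subgroup W) (f : N →* A)
    (hf : Function.Surjective f) (hW : ∀ w : W, w * w = 1) (a : A) : a * a = 1 := by
  obtain ⟨n, rfl⟩ := hf a
  rw [← map_mul]
  have : n * n = 1 := Subtype.ext (by simpa using hW (n : W))
  rw [this, map_one]

variable {Γ A W O : Type*} [Group Γ] [Group A] [Group W] [MulAction Γ O]
  (q : Γ →* A) (hq : ∀ γ : Γ, q γ = 1 → ∀ x : O, γ • x = x)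
  (N : Subgroup W) (f : N →* A) (hf : Function.Surjective f) (hW : ∀ w : W, w * w = 1)
include hq hf hW

/-- **T0(5)(b″), squares.**  Under the lock hypotheses with `W(Δ_λ)` of exponent `2`, every
`γ ∈ Γ''` acts on the live orbit as an involution: `γ • γ • x = x`. -/
theorem smul_smul_self_of_sq_eq_one (γ : Γ) (x : O) : γ • γ • x = x := by
  have h1 : q (γ * γ) = 1 := by rw [map_mul]; exact sq_eq_one_of_subquotient N f hf hW (q γ)
  rw [← mul_smul]
  exact hq (γ * γ) h1 x

/-- **T0(5)(b″), commutators.**  Under the lock hypotheses with `W(Δ_λ)` of exponent `2`, the action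
of `Γ''` on the live orbit is commutative: `γ • δ • x = δ • γ • x`.  With transitivity, the image of
`Γ''` in `Sym(O)` is therefore an elementary abelian `2`-group acting simply transitively, and
`x(K)·M''/M''` is a multiquadratic Galois extension. -/
theorem smul_comm_of_sq_eq_one (γ δ : Γ) (x : O) : γ • δ • x = δ • γ • x := by
  have hA : ∀ a b : A, a * b = b * a := fun a b => by
    have hab := sq_eq_one_of_subquotient N f hf hW (a * b)
    have ha := sq_eq_one_of_subquotient N f hf hW a
    have hb := sq_eq_one_of_subquotient N f hf hW b
    -- `a * b = (a * b)⁻¹ = b⁻¹ * a⁻¹ = b * a`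
    have ia : a⁻¹ = a := inv_eq_of_mul_eq_one_right ha
    have ib : b⁻¹ = b := inv_eq_of_mul_eq_one_right hb
    have iab : (a * b)⁻¹ = a * b := inv_eq_of_mul_eq_one_right hab
    rw [← iab, mul_inv_rev, ia, ib]
  have h1 : q ((δ * γ)⁻¹ * (γ * δ)) = 1 := by
    rw [map_mul, map_inv, map_mul, map_mul, hA (q δ) (q γ), inv_mul_cancel]
  have h2 := hq _ h1 x
  rw [mul_smul, inv_smul_eq_iff] at h2
  rw [← mul_smul, ← mul_smul]
  exact h2

end ExponentTwo

/-- Sanity: the regular action of the Klein four-group on itself satisfies the lock hypotheses with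
`A = W = V₄` of exponent `2` (`m = 4` is not excluded), and the conclusion — commutativity — holds. -/
example (γ δ x : Multiplicative (ZMod 2 × ZMod 2)) : γ • δ • x = δ • γ • x :=
  smul_comm_of_sq_eq_one (MonoidHom.id _)
    (fun γ h x => by rw [MonoidHom.id_apply] at h; rw [h, one_smul])
    (⊤ : Subgroup (Multiplicative (ZMod 2 × ZMod 2))) (Subgroup.subtype ⊤)
    (fun v => ⟨⟨v, Subgroup.mem_top v⟩, rfl⟩)
    (fun w => by
      have h : ∀ z : ZMod 2 × ZMod 2, z + z = 0 := by decide
      exact congrArg Multiplicative.ofAdd (h (Multiplicative.toAdd w)))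
    γ δ x

end Summit.Langlands.Langlands.Theorems.SoloBlind
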